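import Literature.NumberTheory.Transcendental.FeldmanDeltaPolynomials
import Mathlib.NumberTheory.Padics.PadicNumbers
import Mathlib.NumberTheory.Padics.PadicVal.Basic
import HarnessLib

/-!
# Cell abc-stewartyu: the `p`-adic size of the Fel'dman denominators `den(ℓ, H) = (H!)^{⌊ℓ/H⌋}·(ℓ mod H)!`

`Summits/ABC/StewartYu/FeldmanDenValuation.lean` — cell `abc-stewartyu` (HOME `run/shared/lean/pub/abc-stewartyu/`),
seat p5 (g3); support for BOTH records (`p = 2`: the weight slot `Bw3` of `schedTwoS`; odd `p`: p1's allowance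
`AY`).  Theorems only.

By Legendre, `(p−1)·v_p(k!) = k − s_p(k) ≤ k`, so `(p−1)·v_p(den(ℓ,H)) ≤ ⌊ℓ/H⌋·H + (ℓ mod H) = ℓ`
(`sub_one_mul_padicValNat_den_le`), and `‖den(ℓ,H)⁻¹‖_p = p^{v_p(den)} ≤ p^{⌊ℓ/(p−1)⌋}` (`norm_inv_den_le`);
at `p = 2`: `‖den(ℓ,H)⁻¹‖₂ ≤ 2^ℓ` (`norm_inv_den_two_le`).

References: Yu. V. Nesterenko, LNM 1819 (2003), §3.1 (3.4)–(3.6); N. I. Fel'dman, Mat. Sb. 77 (1968), Lemma 2.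
-/

noncomputable section

open Literature.NumberTheory.Transcendental
open Literature.NumberTheory.Transcendental.FeldmanDelta

namespace Summit.ABC.StewartYu

namespace FeldmanDen

variable (p : ℕ) [hp : Fact p.Prime]

/-- Legendre: `(p−1)·v_p(k!) ≤ k`. [folklore] -/
theorem sub_one_mul_padicValNat_factorial_le (k : ℕ) : (p - 1) * padicValNat p (Nat.factorial k) ≤ k := by
  rw [sub_one_mul_padicValNat_factorial]
  exact Nat.sub_le _ _

/-- **`(p−1)·v_p(den(ℓ,H)) ≤ ℓ`.** [cite: Nesterenko2003, §3.1 (3.5)] -/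
theorem sub_one_mul_padicValNat_den_le (ℓ : ℕ) {H : ℕ} (hH : 1 ≤ H) :
    (p - 1) * padicValNat p (den ℓ H) ≤ ℓ := by
  rw [den_eq ℓ hH]
  have h1 : (Nat.factorial H) ^ (ℓ / H) ≠ 0 := pow_ne_zero _ (Nat.factorial_ne_zero H)
  have h2 : Nat.factorial (ℓ % H) ≠ 0 := Nat.factorial_ne_zero _
  rw [padicValNat.mul h1 h2, padicValNat.pow, mul_add]
  have hA := sub_one_mul_padicValNat_factorial_le p H
  have hB := sub_one_mul_padicValNat_factorial_le p (ℓ % H)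
  have e : (p - 1) * (ℓ / H * padicValNat p (Nat.factorial H)) =
      ℓ / H * ((p - 1) * padicValNat p (Nat.factorial H)) := by ring
  rw [e]
  calc ℓ / H * ((p - 1) * padicValNat p (Nat.factorial H)) + (p - 1) * padicValNat p (Nat.factorial (ℓ % H))
      ≤ ℓ / H * H + ℓ % H := Nat.add_le_add (Nat.mul_le_mul_left _ hA) hB
    _ = ℓ := by rw [mul_comm]; exact Nat.div_add_mod ℓ H

/-- `v_p(den(ℓ,H)) ≤ ⌊ℓ/(p−1)⌋`. [cite: Nesterenko2003, §3.1 (3.5)] -/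
theorem padicValNat_den_le (ℓ : ℕ) {H : ℕ} (hH : 1 ≤ H) : padicValNat p (den ℓ H) ≤ ℓ / (p - 1) := by
  have hp1 : 0 < p - 1 := by have := hp.out.two_le; omega
  rw [Nat.le_div_iff_mul_le hp1, mul_comm]
  exact sub_one_mul_padicValNat_den_le p ℓ hH

/-- The `p`-adic norm of the inverse of a nonzero natural: `‖N⁻¹‖_p = p^{v_p(N)}`. [folklore] -/
theorem norm_inv_natCast {N : ℕ} (hN : N ≠ 0) : ‖((N : ℚ_[p]))⁻¹‖ = (p : ℝ) ^ padicValNat p N := by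
  have hN' : (N : ℚ_[p]) ≠ 0 := by exact_mod_cast hN
  rw [norm_inv, Padic.norm_eq_zpow_neg_valuation hN', Padic.valuation_natCast, zpow_neg, inv_inv, zpow_natCast]

/-- **`‖den(ℓ,H)⁻¹‖_p ≤ p^{⌊ℓ/(p−1)⌋}`.** [cite: Nesterenko2003, §3.1 (3.5)–(3.6)] -/
theorem norm_inv_den_le (ℓ : ℕ) {H : ℕ} (hH : 1 ≤ H) :
    ‖((den ℓ H : ℚ_[p]))⁻¹‖ ≤ (p : ℝ) ^ (ℓ / (p - 1)) := by
  rw [norm_inv_natCast p (den_ne_zero ℓ H)]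
  exact pow_le_pow_right₀ (by exact_mod_cast hp.out.one_lt.le) (padicValNat_den_le p ℓ hH)

end FeldmanDen

/-- **At `p = 2`: `‖den(ℓ,H)⁻¹‖₂ ≤ 2^ℓ`.** [cite: Nesterenko2003, §3.1 (3.5)–(3.6)] -/
theorem FeldmanDen.norm_inv_den_two_le (ℓ : ℕ) {H : ℕ} (hH : 1 ≤ H) :
    ‖((den ℓ H : ℚ_[2]))⁻¹‖ ≤ (2 : ℝ) ^ ℓ := by
  have h := FeldmanDen.norm_inv_den_le 2 ℓ hH
  have e : ((2 : ℕ) : ℝ) ^ (ℓ / (2 - 1)) = (2 : ℝ) ^ ℓ := by norm_num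
  rw [e] at h
  exact h

end Summit.ABC.StewartYu

end
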